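import Summits.ResolutionOfSingularities.KangarooAtlas.MizutaniExtremalForm
import Summits.ResolutionOfSingularities.KangarooAtlas.MizutaniRationalPointClosed
import HarnessLib

/-!
# The extremal Hironaka scheme determines its point («associated with a closed point», Mizutani §1 (d), Thm. 2.8 Step (I))

Cell `pub-rosobs`, Mizutani enclosure (seat mizutani-encloser-2, gen 8). AI-written; AI review is weaker than expert review;
NOT a resolution-of-singularities theorem (summit relevance C).

Mizutani (Nagoya Math. J. 52 (1973) §1 (d), p. 86): «We call `𝔭 ∈ ℙ^n` the most generic point associated with an `H`-scheme `B` in `Spec S`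
when `B_{ℙ^n,𝔭} = B` and an arbitrary `y ∈ ℙ^n` which satisfies `B_{ℙ^n,y} = B` contains `𝔭`»; Example 2.1: «… associated with a closed point in
`ℙ^{2p−1}`»; proof of Thm. 2.8, Step (I) (p. 91): «the most generic point associated with `H` is a closed point».  In the tree a point `𝔭`
is a homogeneous prime (`IsPoint`), `B_{P,𝔭} = Spec S/U_+(𝔭)S` with `U_+(𝔭)S = bIdeal k 𝔭`, and this file proves that the EXTREMAL schemes
of Thm. 2.8 (no linear form in `U(𝔭)`, not a vector group, `dim B_{P,𝔭} + 1 = 2p`) have EXACTLY ONE associated point: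

* `ratPoint_smul` — `[(μc)^{1/q}] = [c^{1/q}]` for `μ ≠ 0`;
* `hirForms_eq_of_bIdeal_eq`, `invForms_eq_of_bIdeal_eq`, `exponent_eq_of_bIdeal_eq`, `isVectorGroup_iff_of_bIdeal_eq` — the invariant
  forms, the exponent and vector-group-ness of a point are functions of the scheme `B_{P,𝔭}` (i.e. of the ideal `U_+(𝔭)S`) alone;
* **`eq_of_bIdeal_eq_of_extremal`** — if `𝔭` is extremal and `𝔮` is ANY point of the same `ℙ^n_k` with `B_{P,𝔮} = B_{P,𝔭}`, then `𝔮 = 𝔭`: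
  `𝔮` is extremal as well, so `𝔮 = [c'^{1/p}]` with `(L_B)_1(𝔮) = (L_B)_1(𝔭) = k·a`; the common DUAL point `[a^{1/p}]` has `(L_B)_1 = k·c = k·c'`
  (bi-duality `extremal_of_card_eq`), whence `c' = μc` and `𝔮 = 𝔭`;
* **`eq_of_le_of_extremal`** (appended) — the extremal point is a CLOSED point of `ℙ^n_k`: a point `𝔮 ⊇ 𝔭` equals `𝔭`
  (`MizutaniRationalPointClosed.eq_ratPoint_of_le`); so `𝔭` is «the most generic point associated with `B_{P,𝔭}`» in Mizutani's sense
  (§1 (d)) and it is closed («associated with a closed point»): `isMostGeneric_of_extremal`.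

## References

* H. Mizutani, *Hironaka's additive group schemes*, Nagoya Math. J. 52 (1973) 85–95, §1 (d), Example 2.1, Thm. 2.8 (proof, Step (I)), Prop. 2.5.
  [Mizutani1973HironakaGroupSchemes]
-/

noncomputable section

open MvPolynomial Literature.AlgebraicGeometry.Resolution Literature.AlgebraicGeometry.Resolution.HironakaScheme

namespace Summit.ResolutionOfSingularities.KangarooAtlas.Mizutani

universe u

section Unique

variable (k : Type u) [Field k] (p : ℕ) [hp : Fact p.Prime] [CharP k p] {n : ℕ}

/-- **`[(μc)^{1/q}] = [c^{1/q}]`** for a nonzero scalar `μ`. [folklore] -/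
theorem ratPoint_smul (e : ℕ) {c : Fin (n + 1) → k} {μ : k} (hμ : μ ≠ 0) : ratPoint k p e (μ • c) = ratPoint k p e c := by
  by_cases hc : c = 0
  · subst hc; rw [smul_zero]
  have hμc : μ • c ≠ 0 := smul_ne_zero hμ hc
  haveI : (ratPoint k p e (μ • c)).IsPrime := ratPoint_isPrime
  refine eq_ratPoint_of_forall_sub_mem (isPoint_ratPoint hμc) hc fun i j => ?_
  have h := C_mul_X_pow_sub_mem_ratPoint (k := k) (p := p) (e := e) (c := μ • c) i j
  rw [Pi.smul_apply, Pi.smul_apply, smul_eq_mul, smul_eq_mul, map_mul, map_mul, mul_assoc, mul_assoc, ← mul_sub] at h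
  exact (Ideal.unit_mul_mem_iff_mem _ (IsUnit.map C (Ne.isUnit hμ))).mp h

variable (𝔭 𝔮 : Ideal (MvPolynomial (Fin (n + 1)) k))

/-- **The invariant forms are a function of the scheme**: for points `𝔭, 𝔮` with `U_+(𝔮)S = U_+(𝔭)S`, `U(𝔮) ∩ L_e = U(𝔭) ∩ L_e` for every `e`
(`addForm_mem_bIdeal_iff`: `L_e ∩ U_+S = (U ∩ L)_e`). [cite: Mizutani1973HironakaGroupSchemes, Def. 1.1 and §1 (c)] -/
theorem hirForms_eq_of_bIdeal_eq [𝔭.IsPrime] [𝔮.IsPrime] (hP : IsPoint k 𝔭) (hQ : IsPoint k 𝔮) (h : bIdeal k 𝔮 = bIdeal k 𝔭) (e : ℕ) :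
    hirForms k p 𝔮 e = hirForms k p 𝔭 e := by
  ext a
  rw [← addForm_mem_bIdeal_iff k p 𝔮 hQ, ← addForm_mem_bIdeal_iff k p 𝔭 hP, h]

/-- The same for Oda's `(L_B)_e` (`= U ∩ L_e`, `hirForms_eq_invForms`). [cite: Oda1983HironakaGroupSchemeII, §2 (p. 1168)] -/
theorem invForms_eq_of_bIdeal_eq [𝔭.IsPrime] [𝔮.IsPrime] (hP : IsPoint k 𝔭) (hQ : IsPoint k 𝔮) (h : bIdeal k 𝔮 = bIdeal k 𝔭) (e : ℕ) :
    invForms k p 𝔮 e = invForms k p 𝔭 e := by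
  rw [← hirForms_eq_invForms 𝔮 e, ← hirForms_eq_invForms 𝔭 e, hirForms_eq_of_bIdeal_eq k p 𝔭 𝔮 hP hQ h e]

/-- The exponent is a function of the scheme. [cite: Mizutani1973HironakaGroupSchemes, §1 (c) («the exponent of B_M»)] -/
theorem exponent_eq_of_bIdeal_eq [𝔭.IsPrime] [𝔮.IsPrime] (hP : IsPoint k 𝔭) (hQ : IsPoint k 𝔮) (h : bIdeal k 𝔮 = bIdeal k 𝔭) :
    exponent k p 𝔮 = exponent k p 𝔭 := by
  have hE : ∀ e, ExponentLE k p 𝔮 e ↔ ExponentLE k p 𝔭 e := fun e => by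
    unfold ExponentLE
    simp only [invForms_eq_of_bIdeal_eq k p 𝔭 𝔮 hP hQ h]
  unfold exponent
  congr 1
  ext e
  exact hE e

omit hp [CharP k p] in
/-- Vector-group-ness is a property of the scheme. [cite: Mizutani1973HironakaGroupSchemes, Rem. 1.2] -/
theorem isVectorGroup_iff_of_bIdeal_eq (h : bIdeal k 𝔮 = bIdeal k 𝔭) : IsVectorGroup k 𝔮 ↔ IsVectorGroup k 𝔭 := by
  unfold IsVectorGroup
  rw [h]

/-- **THE EXTREMAL HIRONAKA SCHEME DETERMINES ITS POINT** («associated with a closed point»; the most generic point of §1 (d) is `𝔭` and no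
other point has the same scheme).  Let `𝔭` be a point of `ℙ^n_k` with no linear form in `U(𝔭)`, `B_{P,𝔭}` not a vector group and
`dim B_{P,𝔭} + 1 = 2p`, and let `𝔮` be any point of `ℙ^n_k` with `B_{P,𝔮} = B_{P,𝔭}` (`U_+(𝔮)S = U_+(𝔭)S`).  Then `𝔮 = 𝔭`.
[cite: Mizutani1973HironakaGroupSchemes, §1 (d), Example 2.1 («associated with a closed point»), Thm. 2.8 proof Step (I) («the most generic point associated with H is a closed point»)] -/
theorem eq_of_bIdeal_eq_of_extremal [𝔭.IsPrime] [𝔮.IsPrime] (hP : IsPoint k 𝔭) (hlin : hirForms k p 𝔭 0 = ⊥)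
    (hnv : ¬ IsVectorGroup k 𝔭) (hdim : ringKrullDim (MvPolynomial (Fin (n + 1)) k ⧸ bIdeal k 𝔭) + 1 = (2 * p : WithBot ℕ∞))
    (hQ : IsPoint k 𝔮) (h : bIdeal k 𝔮 = bIdeal k 𝔭) : 𝔮 = 𝔭 := by
  classical
  -- Oda-side hypotheses for `𝔭`
  have hexp := exponent_eq_one_of_not_isVectorGroup k p 𝔭 hP hnv hdim
  have h0 : invForms k p 𝔭 0 = ⊥ := by rw [← hirForms_eq_invForms 𝔭 0]; exact hlin
  have hV := invForms_one_ne_bot_of_exponent_eq_one k p 𝔭 hexp h0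
  have hE1 : ExponentLE k p 𝔭 1 := ((exponent_eq_iff k p 𝔭).mp hexp).1
  have hdim₁ := hdim
  rw [ringKrullDim_quotient_bIdeal_eq_hsDim_holds k p 𝔭 hP, ← hsDimAt_eq_hsDim k p 𝔭 hE1] at hdim₁
  have h1 : hsDimAt k p 𝔭 1 + 1 = 2 * p := by exact_mod_cast hdim₁
  unfold hsDimAt at h1
  have hfin := finrank_invForms_le k p 𝔭 1
  have hdim' : n + 2 = 2 * p + Module.finrank k (invForms k p 𝔭 1) := by omega
  have hn := (card_eq_of_extremal k p 𝔭 hP h0 hV hdim').1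
  -- the invariant form `a` of `𝔭` is one of `𝔮`
  obtain ⟨a, ha, ha0⟩ := Submodule.exists_mem_ne_zero_of_ne_bot hV
  have hinv := invForms_eq_of_bIdeal_eq k p 𝔭 𝔮 hP hQ h
  have haQ : a ∈ invForms k p 𝔮 1 := by rw [hinv 1]; exact ha
  have h0Q : invForms k p 𝔮 0 = ⊥ := by rw [hinv 0]; exact h0
  -- both points are rational with the same dual point `[a^{1/p}]`
  obtain ⟨c, -, heq, -, -, -, hV'⟩ := extremal_of_card_eq k p 𝔭 hP h0 hn ha ha0
  obtain ⟨c₂, hc₂ind, heq₂, -, -, -, hV₂'⟩ := extremal_of_card_eq k p 𝔮 hQ h0Q hn haQ ha0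
  have hc₂0 : c₂ ≠ 0 := fun h => hc₂ind.ne_zero 0 (congr_fun h 0)
  have hmem : c₂ ∈ Submodule.span k ({c} : Set (Fin (n + 1) → k)) := by
    rw [← hV', hV₂']; exact Submodule.mem_span_singleton_self c₂
  obtain ⟨μ, hμ⟩ := Submodule.mem_span_singleton.mp hmem
  have hμ0 : μ ≠ 0 := by
    rintro rfl
    rw [zero_smul] at hμ
    exact hc₂0 hμ.symm
  rw [heq₂, heq, ← hμ, ratPoint_smul k p 1 hμ0]

end Unique

/-! ## Appended (encloser-2 gen 8): the extremal point is closed; it is the most generic point of its scheme -/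

section Closed

variable (k : Type u) [Field k] (p : ℕ) [hp : Fact p.Prime] [CharP k p] {n : ℕ}
  (𝔭 : Ideal (MvPolynomial (Fin (n + 1)) k))

/-- **THE EXTREMAL POINT IS A CLOSED POINT OF `ℙ^n_k`**: if `𝔭` is extremal (a point with no linear form in `U(𝔭)`, `B_{P,𝔭}` not a vector group,
`dim B_{P,𝔭} + 1 = 2p`) and `𝔮 ⊇ 𝔭` is a point, then `𝔮 = 𝔭` (`𝔭 = [c^{1/p}]` is `k^{1/p}`-rational, and such points are closed).
[cite: Mizutani1973HironakaGroupSchemes, Thm. 2.8, proof, Step (I) («the most generic point associated with H is a closed point»)] -/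
theorem eq_of_le_of_extremal [𝔭.IsPrime] (hP : IsPoint k 𝔭) (hlin : hirForms k p 𝔭 0 = ⊥) (hnv : ¬ IsVectorGroup k 𝔭)
    (hdim : ringKrullDim (MvPolynomial (Fin (n + 1)) k ⧸ bIdeal k 𝔭) + 1 = (2 * p : WithBot ℕ∞))
    {𝔮 : Ideal (MvPolynomial (Fin (n + 1)) k)} (hQ : IsPoint k 𝔮) (hle : 𝔭 ≤ 𝔮) : 𝔮 = 𝔭 := by
  have hexp := exponent_eq_one_of_not_isVectorGroup k p 𝔭 hP hnv hdim
  obtain ⟨-, -, c, -, -, hcind, heq, -⟩ := exists_pair_of_exponent_eq_one k p 𝔭 hP hlin hexp hdim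
  have hc0 : c ≠ 0 := fun h => hcind.ne_zero 0 (congr_fun h 0)
  rw [heq] at hle ⊢
  exact eq_ratPoint_of_le hc0 hQ hle

/-- **`𝔭` IS THE MOST GENERIC POINT OF ITS SCHEME, AND IT IS CLOSED** (Mizutani §1 (d): `B_{P,𝔭} = B` and every point `y` with `B_{P,y} = B`
contains `𝔭` — here even equals `𝔭`; and no point lies strictly above `𝔭`).
[cite: Mizutani1973HironakaGroupSchemes, §1 (d) and Thm. 2.8, proof, Step (I)] -/
theorem isMostGeneric_of_extremal [𝔭.IsPrime] (hP : IsPoint k 𝔭) (hlin : hirForms k p 𝔭 0 = ⊥) (hnv : ¬ IsVectorGroup k 𝔭)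
    (hdim : ringKrullDim (MvPolynomial (Fin (n + 1)) k ⧸ bIdeal k 𝔭) + 1 = (2 * p : WithBot ℕ∞)) :
    (∀ 𝔮 : Ideal (MvPolynomial (Fin (n + 1)) k), 𝔮.IsPrime → IsPoint k 𝔮 → bIdeal k 𝔮 = bIdeal k 𝔭 → 𝔭 ≤ 𝔮 ∧ 𝔮 = 𝔭) ∧
    (∀ 𝔮 : Ideal (MvPolynomial (Fin (n + 1)) k), IsPoint k 𝔮 → 𝔭 ≤ 𝔮 → 𝔮 = 𝔭) := by
  refine ⟨fun 𝔮 h𝔮 hQ h => ?_, fun 𝔮 hQ hle => eq_of_le_of_extremal k p 𝔭 hP hlin hnv hdim hQ hle⟩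
  haveI := h𝔮
  have heq := eq_of_bIdeal_eq_of_extremal k p 𝔭 𝔮 hP hlin hnv hdim hQ h
  exact ⟨heq.symm.le, heq⟩

end Closed

end Summit.ResolutionOfSingularities.KangarooAtlas.Mizutani

end
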